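import Mathlib
import Literature.Analysis.FluidPDE.BeltramiFlows

/-!
# The three half-turn screw symmetries of the ABC flow `abc A B C` (any coefficients)

HONEST FRAMING (cell `ns-blowup`, seat `ns-blowup-instab`, human ruling D-0035): nothing here is a
claim about Navier–Stokes blow-up. WHAT THIS IS NOT: not NS evidence; three trigonometric
identities and some sign bookkeeping. They are the EXACT content behind the «V₄ consistency
report» of the cell's X1″ iteration P-X1″-B (refuter T5, planner RULING 13:37Z H2; instab READER v2
2026-08-25): for EVERY coefficient triple `(A, B, C)` — hence for the breathing host
`abc(A(t), B(t), C(t))` at every instant — the maps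

* `S_x : x ↦ (x₀ + π, −x₁, π − x₂)` with linear part `R_x = diag(1, −1, −1)`,
* `S_y : x ↦ (π − x₀, x₁ + π, −x₂)` with linear part `R_y = diag(−1, 1, −1)`,
* `S_z : x ↦ (−x₀, π − x₁, x₂ + π)` with linear part `R_z = diag(−1, −1, 1)`

(representatives of `R ∘ (· + τ)`, `τ ∈ πℤ³`, chosen mod `2πℤ³` so that the identities hold on the
nose; `abc_periodic` moves them by lattice vectors) are symmetries of the flow: `abc A B C (S x) = R (abc A B C x)` (`abc_screw_x/y/z`). Together with
the identity they form a Klein four-group `V₄` (the linear parts commute and square to `1`: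
`screwLinear_*` lemmas), which for `A = B = C` extends by the cyclic axis permutation to
`V₄ ⋊ ℤ₃ ≅ A₄` (T5). The sign lemmas `e1_sign_*` record how the linear parts act on the unstable
directions `e₁(α_i)` of the four `α`-type stagnation points of `abc 1 1 1` in the engine's sign
convention (first component negative): `R_x` PRESERVES them (`α0 ↔ α2`, `α1 ↔ α3`), `R_y` and `R_z`
REVERSE them — whence the forced flux pattern `F(α0) = −F(α1) = F(α2) = −F(α3)` for any
`V₄`-invariant mode (STATUS «READER v2»). The tree's `Literature.Analysis.FluidPDE.ABC.abc`
(Majda–Bertozzi (2.49)) is used as is; no new definitions.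
-/

namespace Summit.NavierStokesRegularity.FluidComputer.ABCHalfTurnScrews

open Real Literature.Analysis.FluidPDE

/-! ## The three screw symmetries as field identities (all `A, B, C`) -/

/-- **Half-turn screw about the `x`-axis**: `abc(x₀ + π, −x₁, π − x₂) = R_x · abc(x)` with
`R_x = diag(1, −1, −1)`, for all coefficients. -/
theorem abc_screw_x (A B C : ℝ) (x : EuclideanSpace ℝ (Fin 3)) :
    ABC.abc A B C !₂[x 0 + π, -x 1, π - x 2]
      = !₂[ABC.abc A B C x 0, -(ABC.abc A B C x 1), -(ABC.abc A B C x 2)] := by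
  ext i
  fin_cases i <;>
    simp [ABC.abc, sin_add_pi, cos_add_pi, sin_pi_sub, cos_pi_sub, sin_neg, cos_neg] <;> ring

/-- **Half-turn screw about the `y`-axis**: `abc(π − x₀, x₁ + π, −x₂) = R_y · abc(x)` with
`R_y = diag(−1, 1, −1)`, for all coefficients. -/
theorem abc_screw_y (A B C : ℝ) (x : EuclideanSpace ℝ (Fin 3)) :
    ABC.abc A B C !₂[π - x 0, x 1 + π, -x 2]
      = !₂[-(ABC.abc A B C x 0), ABC.abc A B C x 1, -(ABC.abc A B C x 2)] := by
  ext i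
  fin_cases i <;>
    simp [ABC.abc, sin_add_pi, cos_add_pi, sin_pi_sub, cos_pi_sub, sin_neg, cos_neg] <;> ring

/-- **Half-turn screw about the `z`-axis**: `abc(−x₀, π − x₁, x₂ + π) = R_z · abc(x)` with
`R_z = diag(−1, −1, 1)`, for all coefficients. -/
theorem abc_screw_z (A B C : ℝ) (x : EuclideanSpace ℝ (Fin 3)) :
    ABC.abc A B C !₂[-x 0, π - x 1, x 2 + π]
      = !₂[-(ABC.abc A B C x 0), -(ABC.abc A B C x 1), ABC.abc A B C x 2] := by
  ext i
  fin_cases i <;>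
    simp [ABC.abc, sin_add_pi, cos_add_pi, sin_pi_sub, cos_pi_sub, sin_neg, cos_neg] <;> ring

/-- `2π`-periodicity of `abc` in each coordinate (so the screw representatives above may be shifted
by lattice vectors `2πℤ³` at will, e.g. to land exactly on a chosen anchor). -/
theorem abc_periodic (A B C : ℝ) (x : EuclideanSpace ℝ (Fin 3)) (n₀ n₁ n₂ : ℤ) :
    ABC.abc A B C !₂[x 0 + n₀ * (2 * π), x 1 + n₁ * (2 * π), x 2 + n₂ * (2 * π)] = ABC.abc A B C x := by
  ext i
  fin_cases i <;> simp [ABC.abc, sin_add_int_mul_two_pi, cos_add_int_mul_two_pi]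

/-! ## The anchors and the sign bookkeeping of the unstable directions

The four `α`-type stagnation points of `abc 1 1 1` are `α0 = (1,5,3)π/4`, `α1 = (3,1,5)π/4`,
`α2 = (5,3,1)π/4`, `α3 = (7,7,7)π/4`, with unstable directions (engine convention, first component
negative) `e₁(α0) ∝ (−1,−1,1)`, `e₁(α1) ∝ (−1,1,1)`, `e₁(α2) ∝ (−1,1,−1)`, `e₁(α3) ∝ (−1,−1,−1)`. -/

/-- The screw `S_x` maps `α0 ↦ α2` (exactly, with the representative of `abc_screw_x` shifted by
`(0, 2π, 0)`), and `α1 ↦ α3`: coordinates check. -/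
theorem screw_x_anchors :
    ((1 : ℝ) * (π / 4) + π = 5 * (π / 4)) ∧ (-(5 * (π / 4)) + 2 * π = 3 * (π / 4)) ∧
      (π - 3 * (π / 4) = 1 * (π / 4)) ∧
    ((3 : ℝ) * (π / 4) + π = 7 * (π / 4)) ∧ (-(1 * (π / 4)) + 2 * π = 7 * (π / 4)) ∧
      (π - 5 * (π / 4) + 2 * π = 7 * (π / 4)) := by
  refine ⟨by ring, by ring, by ring, by ring, by ring, by ring⟩

/-- The screw `S_y` maps `α0 ↦ α1` and `α2 ↦ α3` (coordinates check, lattice shifts as needed). -/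
theorem screw_y_anchors :
    (π - (1 : ℝ) * (π / 4) = 3 * (π / 4)) ∧ (5 * (π / 4) + π - 2 * π = 1 * (π / 4)) ∧
      (-(3 * (π / 4)) + 2 * π = 5 * (π / 4)) ∧
    (π - (5 : ℝ) * (π / 4) + 2 * π = 7 * (π / 4)) ∧ (3 * (π / 4) + π = 7 * (π / 4)) ∧
      (-(1 * (π / 4)) + 2 * π = 7 * (π / 4)) := by
  refine ⟨by ring, by ring, by ring, by ring, by ring, by ring⟩

/-- The screw `S_z` maps `α0 ↦ α3` and `α1 ↦ α2` (coordinates check, lattice shifts as needed). -/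
theorem screw_z_anchors :
    (-((1 : ℝ) * (π / 4)) + 2 * π = 7 * (π / 4)) ∧ (π - 5 * (π / 4) + 2 * π = 7 * (π / 4)) ∧
      (3 * (π / 4) + π = 7 * (π / 4)) ∧
    (-((3 : ℝ) * (π / 4)) + 2 * π = 5 * (π / 4)) ∧ (π - 1 * (π / 4) = 3 * (π / 4)) ∧
      (5 * (π / 4) + π - 2 * π = 1 * (π / 4)) := by
  refine ⟨by ring, by ring, by ring, by ring, by ring, by ring⟩

/-- **`R_x` preserves the unstable directions** (engine convention): `R_x e₁(α0) = e₁(α2)` and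
`R_x e₁(α1) = e₁(α3)`. -/
theorem e1_sign_x :
    (!₂[(-1 : ℝ), -(-1), -(1)] = !₂[(-1 : ℝ), 1, -1]) ∧ (!₂[(-1 : ℝ), -(1), -(1)] = !₂[(-1 : ℝ), -1, -1]) := by
  constructor <;> (ext i; fin_cases i <;> simp)

/-- **`R_y` reverses the unstable directions**: `R_y e₁(α0) = −e₁(α1)` and `R_y e₁(α2) = −e₁(α3)`. -/
theorem e1_sign_y :
    (!₂[-(-1 : ℝ), -1, -(1)] = -!₂[(-1 : ℝ), 1, 1]) ∧ (!₂[-(-1 : ℝ), 1, -(-1)] = -!₂[(-1 : ℝ), -1, -1]) := by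
  constructor <;> (ext i; fin_cases i <;> simp)

/-- **`R_z` reverses the unstable directions**: `R_z e₁(α0) = −e₁(α3)` and `R_z e₁(α1) = −e₁(α2)`. -/
theorem e1_sign_z :
    (!₂[-(-1 : ℝ), -(-1), 1] = -!₂[(-1 : ℝ), -1, -1]) ∧ (!₂[-(-1 : ℝ), -(1), 1] = -!₂[(-1 : ℝ), 1, -1]) := by
  constructor <;> (ext i; fin_cases i <;> simp)

/-- **The forced flux pattern.** If a readout `F` on the four anchors is invariant under the three
screws up to the orientation signs just computed — `F α2 = F α0` (`R_x`), `F α1 = −F α0` (`R_y`),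
`F α3 = −F α0` (`R_z`) — then the whole pattern is `(s, −s, s, −s)`; in particular the four
magnitudes are equal. This is the consistency report a `V₄`-invariant (e.g. simple, real) Floquet
mode must pass. -/
theorem flux_pattern_of_invariant {F : Fin 4 → ℝ}
    (hx : F 2 = F 0) (hy : F 1 = -F 0) (hz : F 3 = -F 0) :
    (F 1 = -F 0 ∧ F 2 = F 0 ∧ F 3 = -F 0) ∧ (|F 0| = |F 1| ∧ |F 1| = |F 2| ∧ |F 2| = |F 3|) := by
  refine ⟨⟨hy, hx, hz⟩, ?_, ?_, ?_⟩
  · rw [hy, abs_neg]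
  · rw [hy, hx, abs_neg]
  · rw [hx, hz, abs_neg]

end Summit.NavierStokesRegularity.FluidComputer.ABCHalfTurnScrews
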